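import Literature.Combinatorics.Optimization.PentagonComplexPsdRank
import Literature.Combinatorics.Optimization.ComplexPsdRankB4
import Literature.LinearAlgebra.Matrix.RankMinors
import HarnessLib

/-!
# Complex psd-minimal polytopes in every dimension: rank-one factors and `S_P = |M| ⊙ |M|`
# (Gouchá–Gouveia–Silva 2017, Theorem 4.1 second statement and Theorem 4.2, all `d`) — PROVED

Source: A. P. Gouchá, J. Gouveia, P. M. Silva, *On ranks of regular polygons*, SIAM J. Discrete Math.
31 (2017) 2612–2625 = arXiv:1610.09868 [GouchaGouveiaSilva2017]; held text `paper:arxiv-1610.09868`,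
p09 (`pNN` = held-text chunk). Printed statements (p09, verbatim): "We start by reformulating
Proposition 3.2 and Theorem 3.5 of [Gouveia2013] in the complex case. The proofs are omitted since they
are virtually the same as those in that paper. **Theorem 4.1.** Let `S_P` be the slack matrix of a
`d`-polytope `P`. Then `rank_psd^ℂ S_P ≥ d+1`. Furthermore, when equality holds, every
`ℂ`-factorization of size `d+1` of `S_P` uses only rank one matrices as factors. The polytopes for which
equality holds are said to be `ℂ`-minimal. […] **Theorem 4.2.** A `d`-polytope `P` with slack matrix
`S_P ∈ ℝ^{f×v}_+` is `ℂ`-minimal if and only if there exists a matrix `M ∈ ℂ^{f×v}` with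
`rank M = d+1` such that `S_P = |M| ⊙ |M|`."

The tree had the first statement of Theorem 4.1 in every dimension
(`add_one_le_of_hasComplexPsdFactorization_slack`, `PentagonComplexPsdRank.lean`) and the rank-one
statement and Theorem 4.2 only for polygons (`d = 2`, same file). This file carries out the omitted
proofs in general, transporting the tree's REAL arguments for GRT 2013 Prop. 2.6 / Prop. 3.2
(`PsdMinimalPolytopes.lean`: compression of a factorization to the kernel of one factor, facet columns
through the facet's slack matrix, vertex rows through the vertex figure) to complex Hermitian factors.

## Contents (all PROVED; no definitions of notions, no named facts)

* `hasComplexPsdFactorization_trace_of_orthogonal` — GRT Prop. 2.6's mechanism over `ℂ`: if Hermitian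
  psd `A_i` are trace-orthogonal to a psd `C`, then `(Tr A_iB_j)` has a complex psd factorization of size
  `K − rank C` (compression by an orthonormal basis of `ker C`); `rank_colFactor_add_le_complex`,
  `rank_rowFactor_add_le_complex`.
* `add_one_le_of_hasComplexPsdFactorization_slack_of_eq` — Theorem 4.1's first statement for a face
  described with additional equalities (as the tree's real `add_one_le_of_hasPsdFactorization_slack_of_eq`).
* `rank_facetFactor_le_one_complex`, `rank_vertexFactor_le_one_complex` and
  **`GouchaGouveiaSilva2017_thm41_rankOne`** — Theorem 4.1, second statement, every dimension `n ≥ 2`,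
  typed exactly as the tree's real `GouveiaRobinsonThomas2013_prop32_rankOne` (rows = vertices, each
  strictly separated from the other points by a linear functional; columns = facets, each tight on an
  `(n−1)`-dimensional set of points).
* (private: a Hermitian psd matrix of rank `≤ 1` is `v v^*`) and **`GouchaGouveiaSilva2017_thm42`** — Theorem 4.2 in every dimension `n ≥ 2`: `S_P` has a complex psd
  factorization of size `n+1` iff `S_P(i,j) = |u_i · v_j|²` with `u_i, v_j ∈ ℂ^{n+1}` (i.e.
  `S_P = |M| ⊙ |M|` with `M = (u_i · v_j)` factoring through `ℂ^{n+1}`; `⇐` is the tree's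
  `HasComplexPsdFactorization.of_normSq`).
-/

noncomputable section

open Matrix Finset

open scoped MatrixOrder ComplexOrder

namespace Literature.Combinatorics.Optimization

/-! ### Compression of a complex psd factorization to the kernel of one factor -/

section CompressionC

variable {K m : ℕ} {G : Submodule ℂ (EuclideanSpace ℂ (Fin K))}

/-- `Tr(P Q) = 0` forces `P Q = 0` for Hermitian psd complex `P, Q`. [folklore] -/
private theorem mul_eq_zero_of_posSemidef_trace_eq_zeroC {P Q : Matrix (Fin K) (Fin K) ℂ}
    (hP : P.PosSemidef) (hQ : Q.PosSemidef) (h : (P * Q).trace = 0) : P * Q = 0 := by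
  classical
  obtain ⟨C, hC⟩ := CStarAlgebra.nonneg_iff_eq_star_mul_self.mp hQ.nonneg
  have hQC : Q = Cᴴ * C := by rw [hC, star_eq_conjTranspose]
  have hsum : (P * Q).trace = ∑ l, star (star (C l)) ⬝ᵥ (P *ᵥ star (C l)) := by
    rw [hQC, ← Matrix.mul_assoc, Matrix.trace_mul_comm]
    simp only [Matrix.trace, Matrix.diag_apply, Matrix.mul_apply, Matrix.conjTranspose_apply,
      dotProduct, Matrix.mulVec, Finset.mul_sum, star_star, Pi.star_apply]
  have hnn : ∀ l, 0 ≤ star (star (C l)) ⬝ᵥ (P *ᵥ star (C l)) := fun l =>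
    hP.dotProduct_mulVec_nonneg (star (C l))
  have hzero : ∀ l, star (star (C l)) ⬝ᵥ (P *ᵥ star (C l)) = 0 := by
    have h0 : ∑ l, star (star (C l)) ⬝ᵥ (P *ᵥ star (C l)) = 0 := by rw [← hsum, h]
    exact fun l => (Finset.sum_eq_zero_iff_of_nonneg fun l _ => hnn l).1 h0 l (Finset.mem_univ l)
  have hker : ∀ l, P *ᵥ star (C l) = 0 := fun l => (hP.dotProduct_mulVec_zero_iff _).1 (hzero l)
  have hPCh : P * Cᴴ = 0 := by
    ext s l
    have := congrFun (hker l) s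
    simpa only [Matrix.mul_apply, Matrix.conjTranspose_apply, Matrix.mulVec, dotProduct,
      Matrix.zero_apply, Pi.zero_apply, Pi.star_apply] using this
  rw [hQC, ← Matrix.mul_assoc, hPCh, Matrix.zero_mul]

/-- The `K × m` matrix of an orthonormal basis of a subspace `G ⊆ ℂ^K`. [folklore] -/
private def onbMatC (b : OrthonormalBasis (Fin m) ℂ G) : Matrix (Fin K) (Fin m) ℂ :=
  Matrix.of fun s a => (b a : EuclideanSpace ℂ (Fin K)) s

/-- `Q Qᴴ v = v` for `v ∈ G`. [folklore] -/
private theorem onbMatC_proj_mulVec (b : OrthonormalBasis (Fin m) ℂ G)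
    {v : EuclideanSpace ℂ (Fin K)} (hv : v ∈ G) :
    (onbMatC b * (onbMatC b)ᴴ) *ᵥ v.ofLp = v.ofLp := by
  classical
  funext s
  have h := b.sum_repr' ⟨v, hv⟩
  have h2 := congrArg (fun w : G => (w : EuclideanSpace ℂ (Fin K)) s) h
  simp only [Submodule.coe_sum, Submodule.coe_smul, Submodule.coe_inner] at h2
  have h3 : ∑ a, (inner ℂ (b a : EuclideanSpace ℂ (Fin K)) v) *
      (b a : EuclideanSpace ℂ (Fin K)) s = v s := by
    simpa [WithLp.ofLp_sum, Finset.sum_apply, smul_eq_mul] using h2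
  rw [← mulVec_mulVec]
  change _ = v s
  rw [← h3]
  simp only [mulVec, dotProduct, onbMatC, conjTranspose_apply, of_apply]
  refine sum_congr rfl fun a _ => ?_
  rw [mul_comm]
  congr 1
  simp [PiLp.inner_apply, mul_comm]

/-- `Q Qᴴ A = A` when the columns of `A` lie in `G`. [folklore] -/
private theorem onbMatC_proj_mul (b : OrthonormalBasis (Fin m) ℂ G) {A : Matrix (Fin K) (Fin K) ℂ}
    (hrange : ∀ w : Fin K → ℂ, WithLp.toLp 2 (A *ᵥ w) ∈ G) :
    onbMatC b * (onbMatC b)ᴴ * A = A := by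
  classical
  ext s t
  have h := congrFun (onbMatC_proj_mulVec b (hrange (Pi.single t 1))) s
  simp only [mulVec_mulVec] at h
  simpa [Matrix.mulVec_single_one] using h

/-- Compression to `G`: `Tr(QᴴAQ · QᴴBQ) = Tr(A B)` for Hermitian `A` with columns in `G`. [folklore] -/
private theorem trace_compressC' (b : OrthonormalBasis (Fin m) ℂ G) {A B : Matrix (Fin K) (Fin K) ℂ}
    (hA : Aᴴ = A) (hrange : ∀ w : Fin K → ℂ, WithLp.toLp 2 (A *ᵥ w) ∈ G) :
    ((onbMatC b)ᴴ * A * onbMatC b * ((onbMatC b)ᴴ * B * onbMatC b)).trace = (A * B).trace := by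
  set Q := onbMatC b with hQ
  have hPA : Q * Qᴴ * A = A := onbMatC_proj_mul b hrange
  have hAP : A * (Q * Qᴴ) = A := by
    have h := congrArg conjTranspose hPA
    rw [conjTranspose_mul, conjTranspose_mul, conjTranspose_conjTranspose, hA] at h
    exact h
  calc (Qᴴ * A * Q * (Qᴴ * B * Q)).trace = ((Qᴴ * A * Q * Qᴴ * B) * Q).trace := by
        simp only [Matrix.mul_assoc]
    _ = (Q * (Qᴴ * A * Q * Qᴴ * B)).trace := Matrix.trace_mul_comm _ _
    _ = ((Q * Qᴴ * A) * (Q * Qᴴ) * B).trace := by simp only [Matrix.mul_assoc]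
    _ = (A * B).trace := by rw [hPA, hAP]

end CompressionC

/-- **GRT Proposition 2.6's mechanism over `ℂ`** (the argument GGS Thm. 4.1 says carries over
verbatim): if Hermitian psd matrices `A_i` of size `K` are all trace-orthogonal to one psd matrix `C`,
then `(Tr(A_i B_j))_{ij}` has a complex psd factorization of size `K − rank C` (compress every factor
to `ker C ⊇ range A_i` by an orthonormal basis). [cite: GouchaGouveiaSilva2017, Thm. 4.1 (p09)] -/
theorem hasComplexPsdFactorization_trace_of_orthogonal {ι κ : Type*} {K : ℕ} {M : ι → κ → ℝ}
    (A : ι → Matrix (Fin K) (Fin K) ℂ) (B : κ → Matrix (Fin K) (Fin K) ℂ)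
    (hA : ∀ i, (A i).PosSemidef) (hB : ∀ j, (B j).PosSemidef)
    (hM : ∀ i j, ((M i j : ℝ) : ℂ) = (A i * B j).trace)
    (C : Matrix (Fin K) (Fin K) ℂ) (hC : C.PosSemidef) (hAC : ∀ i, (A i * C).trace = 0) :
    HasComplexPsdFactorization M (K - C.rank) := by
  classical
  have hAt : ∀ i, (A i)ᴴ = A i := fun i => (hA i).1.eq
  have hCt : Cᴴ = C := hC.1.eq
  have hCA : ∀ i, C * A i = 0 := fun i => by
    have h := mul_eq_zero_of_posSemidef_trace_eq_zeroC (hA i) hC (hAC i)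
    rw [← hCt, ← hAt i, ← conjTranspose_mul, h, conjTranspose_zero]
  -- `G = ker C`, transported to `EuclideanSpace`
  let eW : EuclideanSpace ℂ (Fin K) ≃ₗ[ℂ] (Fin K → ℂ) := WithLp.linearEquiv 2 ℂ (Fin K → ℂ)
  let G : Submodule ℂ (EuclideanSpace ℂ (Fin K)) :=
    (LinearMap.ker C.mulVecLin).map (eW.symm : (Fin K → ℂ) →ₗ[ℂ] EuclideanSpace ℂ (Fin K))
  have hGmem : ∀ v : EuclideanSpace ℂ (Fin K), v ∈ G ↔ C *ᵥ v.ofLp = 0 := fun v => by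
    rw [Submodule.mem_map_equiv, LinearEquiv.symm_symm, LinearMap.mem_ker, Matrix.mulVecLin_apply]
    exact Iff.rfl
  have hAG : ∀ i (w : Fin K → ℂ), WithLp.toLp 2 (A i *ᵥ w) ∈ G := fun i w => by
    rw [hGmem, WithLp.ofLp_toLp, mulVec_mulVec, hCA i, zero_mulVec]
  -- dimension count: `dim ker C = K − rank C`
  have hdim : Module.finrank ℂ G = K - C.rank := by
    have h2 : C.rank + Module.finrank ℂ (LinearMap.ker C.mulVecLin) = K := by
      have := LinearMap.finrank_range_add_finrank_ker C.mulVecLin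
      rw [Module.finrank_fintype_fun_eq_card, Fintype.card_fin] at this
      exact this
    have h3 : Module.finrank ℂ G = Module.finrank ℂ (LinearMap.ker C.mulVecLin) :=
      LinearEquiv.finrank_map_eq _ _
    omega
  let bG := stdOrthonormalBasis ℂ G
  have h : HasComplexPsdFactorization M (Module.finrank ℂ G) := by
    refine ⟨fun i => (onbMatC bG)ᴴ * A i * onbMatC bG, fun j => (onbMatC bG)ᴴ * B j * onbMatC bG,
      fun i => ?_, fun j => ?_, fun i j => ?_⟩
    · exact (hA i).conjTranspose_mul_mul_same (onbMatC bG)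
    · exact (hB j).conjTranspose_mul_mul_same (onbMatC bG)
    · rw [trace_compressC' bG (hAt i) (hAG i), hM]
  exact hdim ▸ h

/-- **GRT Proposition 2.6 over `ℂ`, rank of a column factor**: in a complex psd factorization
`M_{ij} = Tr(A_iB_j)` of size `K`, if the rows on which column `c` vanishes admit no complex psd
factorization of size `< n`, then `rank(B_c) + n ≤ K`. [cite: GouchaGouveiaSilva2017, Thm. 4.1 (p09)] -/
theorem rank_colFactor_add_le_complex {ι κ : Type*} {K : ℕ} {M : ι → κ → ℝ}
    (A : ι → Matrix (Fin K) (Fin K) ℂ) (B : κ → Matrix (Fin K) (Fin K) ℂ)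
    (hA : ∀ i, (A i).PosSemidef) (hB : ∀ j, (B j).PosSemidef)
    (hM : ∀ i j, ((M i j : ℝ) : ℂ) = (A i * B j).trace) (c : κ) {n : ℕ}
    (hlow : ∀ k, HasComplexPsdFactorization (fun (i : {i // M i c = 0}) j => M i.1 j) k → n ≤ k) :
    (B c).rank + n ≤ K := by
  have h := hasComplexPsdFactorization_trace_of_orthogonal (M := fun (i : {i // M i c = 0}) j => M i.1 j)
    (fun i : {i // M i c = 0} => A i.1) B (fun i => hA i.1) hB (fun i j => hM i.1 j) (B c) (hB c)
    (fun i => by rw [← hM]; exact_mod_cast i.2)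
  have h1 := hlow _ h
  have h2 : (B c).rank ≤ K := by simpa using Matrix.rank_le_width (B c)
  omega

/-- **GRT Proposition 2.6 over `ℂ`, rank of a row factor** (transposed form).
[cite: GouchaGouveiaSilva2017, Thm. 4.1 (p09)] -/
theorem rank_rowFactor_add_le_complex {ι κ : Type*} {K : ℕ} {M : ι → κ → ℝ}
    (A : ι → Matrix (Fin K) (Fin K) ℂ) (B : κ → Matrix (Fin K) (Fin K) ℂ)
    (hA : ∀ i, (A i).PosSemidef) (hB : ∀ j, (B j).PosSemidef)
    (hM : ∀ i j, ((M i j : ℝ) : ℂ) = (A i * B j).trace) (r : ι) {n : ℕ}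
    (hlow : ∀ k, HasComplexPsdFactorization (fun i (j : {j // M r j = 0}) => M i j.1) k → n ≤ k) :
    (A r).rank + n ≤ K := by
  refine rank_colFactor_add_le_complex (M := fun j i => M i j) B A hB hA
    (fun j i => by rw [hM, Matrix.trace_mul_comm]) r fun k hk => hlow k ?_
  exact hk.transpose

/-! ### Theorem 4.1, first statement, for faces described with equalities -/

variable {d : ℕ}

/-- **GGS Theorem 4.1, first statement, with equality constraints**: a complex psd factorization of
the slack matrix `(b_j − a_jᵀx_i)` of `conv{x_i} = {y : a_jᵀy ≤ b_j, c_lᵀy = e_l}` of dimension `n ≥ 1`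
has size `≥ n + 1` (each equality as two inequalities with vanishing slack columns).
[cite: GouchaGouveiaSilva2017, Thm. 4.1 (p09)] -/
theorem add_one_le_of_hasComplexPsdFactorization_slack_of_eq {ι κ κ' : Type*} [Fintype ι] [Fintype κ]
    [Fintype κ'] (x : ι → (Fin d → ℝ)) (a : κ → (Fin d → ℝ)) (b : κ → ℝ) (c : κ' → (Fin d → ℝ))
    (e : κ' → ℝ)
    (hP : convexHull ℝ (Set.range x) = {y | (∀ j, a j ⬝ᵥ y ≤ b j) ∧ ∀ l, c l ⬝ᵥ y = e l})
    {n : ℕ} (hn : Module.finrank ℝ (vectorSpan ℝ (Set.range x)) = n) (h1 : 1 ≤ n) {k : ℕ}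
    (hk : HasComplexPsdFactorization (fun i j => b j - a j ⬝ᵥ x i) k) : n + 1 ≤ k := by
  classical
  let a' : κ ⊕ (κ' ⊕ κ') → (Fin d → ℝ) := Sum.elim a (Sum.elim c fun l => -c l)
  let b' : κ ⊕ (κ' ⊕ κ') → ℝ := Sum.elim b (Sum.elim e fun l => -e l)
  have hP' : convexHull ℝ (Set.range x) = {y | ∀ j, a' j ⬝ᵥ y ≤ b' j} := by
    rw [hP]
    ext y
    simp only [Set.mem_setOf_eq, Sum.forall, a', b', Sum.elim_inl, Sum.elim_inr, neg_dotProduct,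
      neg_le_neg_iff]
    constructor
    · rintro ⟨h₁, h₂⟩
      exact ⟨h₁, fun l => (h₂ l).le, fun l => (h₂ l).ge⟩
    · rintro ⟨h₁, h₂, h₃⟩
      exact ⟨h₁, fun l => le_antisymm (h₂ l) (h₃ l)⟩
  have hxeq : ∀ i l, c l ⬝ᵥ x i = e l := fun i => by
    have hi : x i ∈ {y : Fin d → ℝ | (∀ j, a j ⬝ᵥ y ≤ b j) ∧ ∀ l, c l ⬝ᵥ y = e l} := by
      rw [← hP]; exact subset_convexHull ℝ _ (Set.mem_range_self i)
    exact hi.2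
  have hk' : HasComplexPsdFactorization (fun i j => b' j - a' j ⬝ᵥ x i) k := by
    obtain ⟨A, B, hA, hB, hM⟩ := hk
    refine ⟨A, Sum.elim B fun _ => 0, hA, ?_, ?_⟩
    · rintro (j | j)
      · exact hB j
      · exact PosSemidef.zero
    · rintro i (j | (l | l))
      · exact hM i j
      · simp [a', b', hxeq i l]
      · simp [a', b', neg_dotProduct, hxeq i l]
  exact add_one_le_of_hasComplexPsdFactorization_slack x a' b' hP' hn h1 hk'

/-! ### Theorem 4.1, second statement: facet columns -/

/-- **GGS Theorem 4.1, second statement, facet factors**: for a `V`/`H`-described polytope of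
dimension `n ≥ 2` and an inequality `c` tight on an `(n−1)`-dimensional set of points (a facet), the
factor `B_c` of a complex psd factorization of size `n + 1` has rank `≤ 1` (the facet's slack matrix
has complex psd rank `≥ n`; then `rank_colFactor_add_le_complex`).
[cite: GouchaGouveiaSilva2017, Thm. 4.1 (p09)] -/
theorem rank_facetFactor_le_one_complex {ι κ : Type*} [Fintype ι] [Fintype κ] (x : ι → (Fin d → ℝ))
    (a : κ → (Fin d → ℝ)) (b : κ → ℝ) (hP : convexHull ℝ (Set.range x) = {y | ∀ j, a j ⬝ᵥ y ≤ b j})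
    {n : ℕ} (hn : 2 ≤ n) (c : κ)
    (hfacet : Module.finrank ℝ (vectorSpan ℝ (Set.range fun i : {i : ι // a c ⬝ᵥ x i = b c} => x i.1)) + 1 = n)
    (A : ι → Matrix (Fin (n + 1)) (Fin (n + 1)) ℂ) (B : κ → Matrix (Fin (n + 1)) (Fin (n + 1)) ℂ)
    (hA : ∀ i, (A i).PosSemidef) (hB : ∀ j, (B j).PosSemidef)
    (hS : ∀ i j, (((b j - a j ⬝ᵥ x i : ℝ)) : ℂ) = (A i * B j).trace) : (B c).rank ≤ 1 := by
  classical
  have hF' : convexHull ℝ (Set.range fun i : {i : ι // a c ⬝ᵥ x i = b c} => x i.1) =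
      {y | (∀ j, a j ⬝ᵥ y ≤ b j) ∧ ∀ _l : Unit, a c ⬝ᵥ y = b c} := by
    rw [convexHull_range_tight_eq x a b hP c]
    ext y
    simp only [Set.mem_setOf_eq, forall_const]
    constructor
    · rintro ⟨h1, h2⟩; exact ⟨h1, le_antisymm (h1 c) h2⟩
    · rintro ⟨h1, h2⟩; exact ⟨h1, h2.symm.le⟩
  have hn1 : Module.finrank ℝ (vectorSpan ℝ (Set.range fun i : {i : ι // a c ⬝ᵥ x i = b c} => x i.1)) =
      n - 1 := by omega
  have hlow : ∀ k, HasComplexPsdFactorization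
      (fun (i : {i : ι // (fun i j => b j - a j ⬝ᵥ x i) i c = 0}) j => b j - a j ⬝ᵥ x i.1) k → n ≤ k := by
    intro k hk
    have hk' : HasComplexPsdFactorization
        (fun (i : {i : ι // a c ⬝ᵥ x i = b c}) j => b j - a j ⬝ᵥ x i.1) k :=
      hk.submatrix (fun i : {i : ι // a c ⬝ᵥ x i = b c} =>
        (⟨i.1, sub_eq_zero.mpr i.2.symm⟩ : {i : ι // (fun i j => b j - a j ⬝ᵥ x i) i c = 0})) id
    have h := add_one_le_of_hasComplexPsdFactorization_slack_of_eq
      (fun i : {i : ι // a c ⬝ᵥ x i = b c} => x i.1) a b (fun _ : Unit => a c) (fun _ => b c) hF'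
      hn1 (by omega) hk'
    omega
  have h := rank_colFactor_add_le_complex (M := fun i j => b j - a j ⬝ᵥ x i) A B hA hB hS c hlow
  omega

/-! ### Theorem 4.1, second statement: vertex rows (through the vertex figure) -/

/-- Convex-hull membership of a finite family as a convex combination with weights on the whole
index type. [folklore] -/
private theorem exists_weights_of_mem_convexHull' {ι : Type*} [Fintype ι] {E : Type*} [AddCommGroup E]
    [Module ℝ E] (x : ι → E) {y : E} (hy : y ∈ convexHull ℝ (Set.range x)) :
    ∃ w : ι → ℝ, (∀ i, 0 ≤ w i) ∧ ∑ i, w i = 1 ∧ ∑ i, w i • x i = y := by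
  classical
  rw [convexHull_range_eq_exists_affineCombination] at hy
  obtain ⟨s, w, hw₀, hw₁, rfl⟩ := hy
  refine ⟨fun i => if i ∈ s then w i else 0, fun i => ?_, ?_, ?_⟩
  · by_cases hi : i ∈ s
    · simpa [hi] using hw₀ i hi
    · simp [hi]
  · rw [Finset.sum_ite_mem, Finset.univ_inter, hw₁]
  · rw [Finset.affineCombination_eq_linear_combination s x w hw₁]
    simp only [ite_smul, zero_smul, Finset.sum_ite_mem, Finset.univ_inter]


/-- **GGS Theorem 4.1, second statement, vertex factors**: for a `V`/`H`-described polytope of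
dimension `n ≥ 2` and a point `x_p` strictly separated from the other points by a linear functional
`c` (a vertex), the factor `A_p` of a complex psd factorization of size `n + 1` has rank `≤ 1`. The
proof is the tree's real one (`rank_vertexFactor_le_one`: the columns tight at `x_p`, on the rows
`x_i ≠ x_p` rescaled by `cᵀ(x_i − x_p) > 0`, form the slack matrix of the `(n−1)`-dimensional vertex
figure, which has complex psd rank `≥ n`; then `rank_rowFactor_add_le_complex`).
[cite: GouchaGouveiaSilva2017, Thm. 4.1 (p09)] -/
theorem rank_vertexFactor_le_one_complex {ι κ : Type*} [Fintype ι] [Fintype κ] (x : ι → (Fin d → ℝ))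
    (a : κ → (Fin d → ℝ)) (b : κ → ℝ) (hP : convexHull ℝ (Set.range x) = {y | ∀ j, a j ⬝ᵥ y ≤ b j})
    {n : ℕ} (hn : 2 ≤ n) (hdim : Module.finrank ℝ (vectorSpan ℝ (Set.range x)) = n) (p : ι)
    (c : Fin d → ℝ) (hc : ∀ i, x i ≠ x p → c ⬝ᵥ x p < c ⬝ᵥ x i)
    (A : ι → Matrix (Fin (n + 1)) (Fin (n + 1)) ℂ) (B : κ → Matrix (Fin (n + 1)) (Fin (n + 1)) ℂ)
    (hA : ∀ i, (A i).PosSemidef) (hB : ∀ j, (B j).PosSemidef)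
    (hS : ∀ i j, (((b j - a j ⬝ᵥ x i : ℝ)) : ℂ) = (A i * B j).trace) : (A p).rank ≤ 1 := by
  classical
  have hxP : ∀ i j, a j ⬝ᵥ x i ≤ b j := fun i => by
    have hi : x i ∈ convexHull ℝ (Set.range x) := subset_convexHull ℝ _ (Set.mem_range_self i)
    rw [hP] at hi
    exact hi
  -- the separating values `ℓ_i = cᵀ(x_i − x_p) > 0`
  let ℓ : ι → ℝ := fun i => c ⬝ᵥ (x i - x p)
  have hℓ : ∀ i : {i : ι // x i ≠ x p}, 0 < ℓ i.1 := fun i => by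
    have := hc i.1 i.2
    simp only [ℓ, dotProduct_sub]; linarith
  -- the vertex figure points `y_i = x_p + (x_i − x_p)/ℓ_i`
  let y : {i : ι // x i ≠ x p} → (Fin d → ℝ) := fun i => x p + (ℓ i.1)⁻¹ • (x i.1 - x p)
  have hcy : ∀ i, c ⬝ᵥ y i = c ⬝ᵥ x p + 1 := fun i => by
    simp only [y, dotProduct_add, dotProduct_smul, smul_eq_mul]
    rw [show c ⬝ᵥ (x i.1 - x p) = ℓ i.1 from rfl, inv_mul_cancel₀ (hℓ i).ne']
  have hslack : ∀ (i : {i : ι // x i ≠ x p}) (j : {j : κ // a j ⬝ᵥ x p = b j}),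
      b j.1 - a j.1 ⬝ᵥ y i = (ℓ i.1)⁻¹ * (b j.1 - a j.1 ⬝ᵥ x i.1) := fun i j => by
    simp only [y, dotProduct_add, dotProduct_smul, smul_eq_mul, dotProduct_sub]
    rw [j.2]; ring
  -- the `H`-description of the vertex figure
  have hQ : convexHull ℝ (Set.range y) =
      {z | (∀ j : {j : κ // a j ⬝ᵥ x p = b j}, a j.1 ⬝ᵥ z ≤ b j.1) ∧ ∀ _l : Unit, c ⬝ᵥ z = c ⬝ᵥ x p + 1} := by
    apply Set.Subset.antisymm
    · refine convexHull_min ?_ ?_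
      · rintro _ ⟨i, rfl⟩
        refine ⟨fun j => ?_, fun _ => hcy i⟩
        have h := hslack i j
        have h2 : 0 ≤ (ℓ i.1)⁻¹ * (b j.1 - a j.1 ⬝ᵥ x i.1) :=
          mul_nonneg (inv_nonneg.mpr (hℓ i).le) (sub_nonneg.mpr (hxP _ _))
        linarith
      · intro z₁ hz₁ z₂ hz₂ α β hα hβ hαβ
        refine ⟨fun j => ?_, fun _ => ?_⟩
        · have h₁ := hz₁.1 j; have h₂ := hz₂.1 j
          rw [dotProduct_add, dotProduct_smul, dotProduct_smul, smul_eq_mul, smul_eq_mul]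
          calc α * (a j.1 ⬝ᵥ z₁) + β * (a j.1 ⬝ᵥ z₂) ≤ α * b j.1 + β * b j.1 :=
                add_le_add (mul_le_mul_of_nonneg_left h₁ hα) (mul_le_mul_of_nonneg_left h₂ hβ)
            _ = b j.1 := by rw [← add_mul, hαβ, one_mul]
        · have h₁ := hz₁.2 (); have h₂ := hz₂.2 ()
          rw [dotProduct_add, dotProduct_smul, dotProduct_smul, smul_eq_mul, smul_eq_mul, h₁, h₂,
            ← add_mul, hαβ, one_mul]
    · rintro z ⟨hzT, hzc⟩
      have hzc' : c ⬝ᵥ (z - x p) = 1 := by rw [dotProduct_sub, hzc ()]; ring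
      -- a small step from `x_p` towards `z` stays in `P`
      have hstep : ∀ᶠ t in nhdsWithin (0 : ℝ) (Set.Ioi 0), ∀ j, a j ⬝ᵥ (x p + t • (z - x p)) ≤ b j := by
        rw [Filter.eventually_all]
        intro j
        by_cases hj : a j ⬝ᵥ x p = b j
        · filter_upwards [self_mem_nhdsWithin] with t ht
          have hz := hzT ⟨j, hj⟩
          rw [dotProduct_add, dotProduct_smul, smul_eq_mul, hj, dotProduct_sub]
          nlinarith [(show (0:ℝ) < t from ht).le]
        · have hslt : a j ⬝ᵥ x p < b j := lt_of_le_of_ne (hxP p j) hj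
          have ht : Filter.Tendsto (fun t : ℝ => a j ⬝ᵥ x p + t * (a j ⬝ᵥ (z - x p)))
              (nhdsWithin (0 : ℝ) (Set.Ioi 0)) (nhds (a j ⬝ᵥ x p + 0 * (a j ⬝ᵥ (z - x p)))) :=
            tendsto_nhdsWithin_of_tendsto_nhds
              ((continuous_const.add (continuous_id.mul continuous_const)).tendsto 0)
          rw [zero_mul, add_zero] at ht
          filter_upwards [ht.eventually (gt_mem_nhds hslt)] with t ht'
          rw [dotProduct_add, dotProduct_smul, smul_eq_mul]
          exact ht'.le
      obtain ⟨t, ht, ht0⟩ := (hstep.and self_mem_nhdsWithin).exists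
      have ht0 : (0 : ℝ) < t := ht0
      -- `w = x_p + t (z − x_p) ∈ P = conv{x_i}`
      have hw : x p + t • (z - x p) ∈ convexHull ℝ (Set.range x) := by rw [hP]; exact ht
      obtain ⟨μ, hμ0, hμ1, hμw⟩ := exists_weights_of_mem_convexHull' x hw
      -- `Σ μ_i (x_i − x_p) = t (z − x_p)`
      have hsum : ∑ i, μ i • (x i - x p) = t • (z - x p) := by
        have : ∑ i, μ i • (x i - x p) = ∑ i, μ i • x i - (∑ i, μ i) • x p := by
          rw [Finset.sum_smul, ← Finset.sum_sub_distrib]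
          refine Finset.sum_congr rfl fun i _ => by rw [smul_sub]
        rw [this, hμw, hμ1, one_smul, add_sub_cancel_left]
      -- only the rows `x_i ≠ x_p` contribute
      have hsum' : ∑ i : {i : ι // x i ≠ x p}, μ i.1 • (x i.1 - x p) = t • (z - x p) := by
        have hzero : ∑ i : {i : ι // ¬ (x i ≠ x p)}, μ i.1 • (x i.1 - x p) = 0 :=
          Finset.sum_eq_zero fun i _ => by
            have : x i.1 = x p := by simpa using i.2
            rw [this, sub_self, smul_zero]
        rw [← hsum, ← Fintype.sum_subtype_add_sum_subtype (fun i => x i ≠ x p) (fun i => μ i • (x i - x p)),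
          hzero, add_zero]
      -- the weights `ν_i = μ_i ℓ_i / t`
      let ν : {i : ι // x i ≠ x p} → ℝ := fun i => μ i.1 * ℓ i.1 / t
      have hν0 : ∀ i, 0 ≤ ν i := fun i => div_nonneg (mul_nonneg (hμ0 _) (hℓ i).le) ht0.le
      have hνsum : ∑ i, ν i = 1 := by
        -- apply `c` to `hsum'`
        have h := congrArg (fun v => c ⬝ᵥ v) hsum'
        simp only [dotProduct_sum, dotProduct_smul, smul_eq_mul, hzc', mul_one] at h
        simp only [ν]
        rw [← Finset.sum_div, h, div_self ht0.ne']
      have hνy : ∑ i, ν i • y i = z := by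
        have e : ∀ i : {i : ι // x i ≠ x p}, ν i • y i = ν i • x p + t⁻¹ • (μ i.1 • (x i.1 - x p)) := by
          intro i
          simp only [y, ν, smul_add, smul_smul]
          congr 1
          rw [show μ i.1 * ℓ i.1 / t * (ℓ i.1)⁻¹ = t⁻¹ * μ i.1 by field_simp [(hℓ i).ne', ht0.ne']]
        rw [Finset.sum_congr rfl fun i _ => e i, Finset.sum_add_distrib, ← Finset.sum_smul, hνsum,
          one_smul, ← Finset.smul_sum, hsum', smul_smul, inv_mul_cancel₀ ht0.ne', one_smul,
          add_sub_cancel]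
      rw [← hνy]
      exact (convex_convexHull ℝ _).sum_mem (fun i _ => hν0 i) hνsum
        fun i _ => subset_convexHull ℝ _ (Set.mem_range_self i)
  -- dimension of the vertex figure: `n ≤ dim + 1`
  have hdimQ : n ≤ Module.finrank ℝ (vectorSpan ℝ (Set.range y)) + 1 := by
    -- a point different from `x_p` exists
    have hne : ∃ i, x i ≠ x p := by
      by_contra h
      push Not at h
      have hr : Set.range x = {x p} := by
        ext v; simp only [Set.mem_range, Set.mem_singleton_iff]
        exact ⟨fun ⟨i, hi⟩ => hi ▸ h i, fun hv => ⟨p, hv.symm⟩⟩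
      rw [hr, vectorSpan_singleton, finrank_bot] at hdim
      omega
    obtain ⟨i0, hi0⟩ := hne
    let I0 : {i : ι // x i ≠ x p} := ⟨i0, hi0⟩
    have hV : vectorSpan ℝ (Set.range x) ≤
        (ℝ ∙ (y I0 - x p)) ⊔ vectorSpan ℝ (Set.range y) := by
      rw [vectorSpan_range_eq_span_range_vsub_right ℝ x p, Submodule.span_le]
      rintro _ ⟨i, rfl⟩
      simp only [vsub_eq_sub, SetLike.mem_coe]
      by_cases hi : x i = x p
      · rw [hi, sub_self]; exact Submodule.zero_mem _
      · -- `x_i − x_p = ℓ_i • (y_i − x_p) = ℓ_i • ((y_i − y_{i0}) + (y_{i0} − x_p))`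
        have e : x i - x p = ℓ i • ((y ⟨i, hi⟩ - y I0) + (y I0 - x p)) := by
          have : y ⟨i, hi⟩ - x p = (ℓ i)⁻¹ • (x i - x p) := by simp only [y]; abel
          rw [sub_add_sub_cancel, this, smul_smul, mul_inv_cancel₀ (hℓ ⟨i, hi⟩).ne', one_smul]
        rw [e]
        refine Submodule.smul_mem _ _ (Submodule.add_mem _ ?_ ?_)
        · exact Submodule.mem_sup_right (vsub_mem_vectorSpan ℝ (Set.mem_range_self _) (Set.mem_range_self _))
        · exact Submodule.mem_sup_left (Submodule.mem_span_singleton_self _)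
    have h1 : Module.finrank ℝ (ℝ ∙ (y I0 - x p)) ≤ 1 := by
      have := finrank_span_le_card (R := ℝ) ({y I0 - x p} : Set (Fin d → ℝ))
      simpa using this
    have h2 := Submodule.finrank_mono hV
    have h3 := Submodule.finrank_add_le_finrank_add_finrank (ℝ ∙ (y I0 - x p)) (vectorSpan ℝ (Set.range y))
    omega
  -- the row bound
  have h := rank_rowFactor_add_le_complex (M := fun i j => b j - a j ⬝ᵥ x i) A B hA hB hS p (n := n) fun k hk => by
    -- restrict to the rows `x_i ≠ x_p`, reindex the tight columns, rescale the rows by `ℓ_i⁻¹`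
    have hk1 : HasComplexPsdFactorization
        (fun (i : {i : ι // x i ≠ x p}) (j : {j : κ // a j ⬝ᵥ x p = b j}) => b j.1 - a j.1 ⬝ᵥ x i.1) k :=
      hk.submatrix (fun i : {i : ι // x i ≠ x p} => i.1)
        (fun j : {j : κ // a j ⬝ᵥ x p = b j} =>
          (⟨j.1, sub_eq_zero.mpr j.2.symm⟩ : {j : κ // (fun i j => b j - a j ⬝ᵥ x i) p j = 0}))
    have hk2 : HasComplexPsdFactorization
        (fun (i : {i : ι // x i ≠ x p}) (j : {j : κ // a j ⬝ᵥ x p = b j}) => b j.1 - a j.1 ⬝ᵥ y i) k := by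
      have h := hk1.rowScale (d := fun i => (ℓ i.1)⁻¹) (fun i => inv_nonneg.mpr (hℓ i).le)
      have e : (fun (i : {i : ι // x i ≠ x p}) (j : {j : κ // a j ⬝ᵥ x p = b j}) => b j.1 - a j.1 ⬝ᵥ y i) =
          fun i j => (ℓ i.1)⁻¹ * (b j.1 - a j.1 ⬝ᵥ x i.1) := by
        funext i j; rw [hslack]
      rw [e]; exact h
    have := add_one_le_of_hasComplexPsdFactorization_slack_of_eq y (fun j : {j : κ // a j ⬝ᵥ x p = b j} => a j.1)
      (fun j => b j.1) (fun _ : Unit => c) (fun _ => c ⬝ᵥ x p + 1) hQ rfl (by omega) hk2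
    omega
  omega

/-- **GGS Theorem 4.1, second statement, every dimension** (p09: "when equality holds, every
`ℂ`-factorization of size `d+1` of `S_P` uses only rank one matrices as factors"), typed as the tree's
real `GouveiaRobinsonThomas2013_prop32_rankOne`: for the slack matrix of a `V`/`H`-described
`n`-polytope (`n ≥ 2`; rows = vertices, columns = facets) every factor of a complex psd factorization
of size `n + 1` has rank `≤ 1`. [cite: GouchaGouveiaSilva2017, Thm. 4.1 (p09)] -/
theorem GouchaGouveiaSilva2017_thm41_rankOne {ι κ : Type*} [Fintype ι] [Fintype κ]
    (x : ι → (Fin d → ℝ)) (a : κ → (Fin d → ℝ)) (b : κ → ℝ)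
    (hP : convexHull ℝ (Set.range x) = {y | ∀ j, a j ⬝ᵥ y ≤ b j})
    {n : ℕ} (hn : 2 ≤ n) (hdim : Module.finrank ℝ (vectorSpan ℝ (Set.range x)) = n)
    (hvert : ∀ p, ∃ c : Fin d → ℝ, ∀ i, x i ≠ x p → c ⬝ᵥ x p < c ⬝ᵥ x i)
    (hfacet : ∀ j, Module.finrank ℝ
      (vectorSpan ℝ (Set.range fun i : {i : ι // a j ⬝ᵥ x i = b j} => x i.1)) + 1 = n)
    (A : ι → Matrix (Fin (n + 1)) (Fin (n + 1)) ℂ) (B : κ → Matrix (Fin (n + 1)) (Fin (n + 1)) ℂ)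
    (hA : ∀ i, (A i).PosSemidef) (hB : ∀ j, (B j).PosSemidef)
    (hS : ∀ i j, (((b j - a j ⬝ᵥ x i : ℝ)) : ℂ) = (A i * B j).trace) :
    (∀ i, (A i).rank ≤ 1) ∧ ∀ j, (B j).rank ≤ 1 :=
  ⟨fun i => by
    obtain ⟨c, hc⟩ := hvert i
    exact rank_vertexFactor_le_one_complex x a b hP hn hdim i c hc A B hA hB hS,
   fun j => rank_facetFactor_le_one_complex x a b hP hn j (hfacet j) A B hA hB hS⟩

/-! ### Theorem 4.2 in every dimension: `S_P = |M| ⊙ |M|` -/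

/-- A Hermitian psd complex matrix of rank `≤ 1` is `v v^*` (if `X ≠ 0`, some diagonal entry
`X_tt > 0` and `X = X e_t (X e_t)^* / X_tt` by the vanishing `2 × 2` minors). [folklore] -/
private theorem eq_vecMulVec_of_posSemidef_rank_le_one {k : ℕ} {X : Matrix (Fin k) (Fin k) ℂ}
    (hX : X.PosSemidef) (hr : X.rank ≤ 1) : ∃ v : Fin k → ℂ, X = vecMulVec v (star v) := by
  classical
  by_cases h0 : X = 0
  · exact ⟨0, by rw [h0]; ext s t; simp [vecMulVec_apply]⟩
  -- a nonzero diagonal entry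
  obtain ⟨C, hC⟩ := CStarAlgebra.nonneg_iff_eq_star_mul_self.mp hX.nonneg
  have hXC : X = Cᴴ * C := by rw [hC, star_eq_conjTranspose]
  have hdiag : ∃ t, X t t ≠ 0 := by
    by_contra hall
    push Not at hall
    apply h0
    -- every column of `C` vanishes
    have hcol : ∀ t l, C l t = 0 := fun t l => by
      have h1 : X t t = ∑ l, star (C l t) * C l t := by
        rw [hXC, Matrix.mul_apply]; rfl
      have h2 : ∑ l, star (C l t) * C l t = ∑ l, ((Complex.normSq (C l t) : ℝ) : ℂ) :=
        Finset.sum_congr rfl fun l _ => by rw [Complex.star_def, Complex.normSq_eq_conj_mul_self]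
      have h3 : ∑ l, Complex.normSq (C l t) = 0 := by
        have := hall t
        rw [h1, h2] at this
        exact_mod_cast this
      have h4 := (Finset.sum_eq_zero_iff_of_nonneg fun l _ => Complex.normSq_nonneg (C l t)).mp h3 l
        (Finset.mem_univ l)
      exact Complex.normSq_eq_zero.mp h4
    ext s u
    rw [hXC, Matrix.mul_apply]
    simp [hcol]
  obtain ⟨t, ht⟩ := hdiag
  -- `X_tt` is a positive real
  have httre : X t t = ((X t t).re : ℂ) := by
    have h := hX.1.apply t t
    rw [Complex.ext_iff]
    refine ⟨by simp, ?_⟩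
    have : (X t t).im = -(X t t).im := by
      conv_lhs => rw [← h]
      simp
    simp only [Complex.ofReal_im]
    linarith
  have htpos : 0 < (X t t).re := by
    have h' : 0 ≤ X t t := hX.diag_nonneg
    rcases (Complex.nonneg_iff.mp h').1.eq_or_lt with h1 | h1
    · exfalso; apply ht; rw [httre, ← h1]; simp
    · exact h1
  -- the `2 × 2` minors through `(t,t)` vanish
  have hminor : ∀ s u, X s u * X t t = X s t * X t u := fun s u => by
    have h := Literature.LinearAlgebra.Matrix.det_submatrix_eq_zero_of_rank_lt_card X ![s, t] ![u, t]
      (by simp; omega)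
    rw [Matrix.det_fin_two] at h
    simp at h
    linear_combination h
  set r : ℝ := Real.sqrt (X t t).re with hr
  have hr0 : (r : ℂ) ≠ 0 := by
    rw [Ne, Complex.ofReal_eq_zero, hr]
    exact (Real.sqrt_pos.mpr htpos).ne'
  have hrr : (r : ℂ) * r = X t t := by
    rw [httre, ← Complex.ofReal_mul, hr, Real.mul_self_sqrt htpos.le]
  refine ⟨fun s => X s t / r, ?_⟩
  ext s u
  simp only [vecMulVec_apply, Pi.star_apply, star_div₀, Complex.star_def, Complex.conj_ofReal]
  have hconj : (starRingEnd ℂ) (X u t) = X t u := by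
    have := hX.1.apply t u
    rwa [Complex.star_def] at this
  rw [hconj]
  field_simp
  rw [sq, hrr]
  linear_combination hminor s u

/-- `Tr(aa^* · bb^*) = |a^*b|²`. [folklore] -/
private theorem trace_vecMulVec_mul_vecMulVec' {k : ℕ} (a b : Fin k → ℂ) :
    (vecMulVec a (star a) * vecMulVec b (star b)).trace =
      ((Complex.normSq (star a ⬝ᵥ b) : ℝ) : ℂ) := by
  rw [← Complex.mul_conj]
  simp only [trace, diag_apply, mul_apply, vecMulVec_apply, dotProduct, Pi.star_apply,
    Complex.star_def, map_sum, map_mul, Complex.conj_conj, Finset.sum_mul_sum]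
  rw [Finset.sum_comm]
  exact Finset.sum_congr rfl fun s _ => Finset.sum_congr rfl fun t _ => by ring

/-- **GGS Theorem 4.2, every dimension** (p09, verbatim: "A `d`-polytope `P` with slack matrix
`S_P ∈ ℝ^{f×v}_+` is `ℂ`-minimal if and only if there exists a matrix `M ∈ ℂ^{f×v}` with
`rank M = d+1` such that `S_P = |M| ⊙ |M|`"), typed as the tree's polygon case
`IsConvexPolygon.hasComplexPsdFactorization_three_iff`: for the slack matrix of a `V`/`H`-described
`n`-polytope (`n ≥ 2`; rows = vertices, columns = facets), a complex psd factorization of size `n + 1`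
exists iff `S_P(i,j) = |u_i · v_j|²` for vectors `u_i, v_j ∈ ℂ^{n+1}` (i.e. `S_P = |M| ⊙ |M|` with `M`
factoring through `ℂ^{n+1}`). `⇒`: Theorem 4.1's rank-one factors `A_i = a_ia_i^*`, `B_j = b_jb_j^*`
give `S_P(i,j) = |a_i^*b_j|²`; `⇐`: `HasComplexPsdFactorization.of_normSq`.
[cite: GouchaGouveiaSilva2017, Thm. 4.2 (p09)] -/
theorem GouchaGouveiaSilva2017_thm42 {ι κ : Type*} [Fintype ι] [Fintype κ]
    (x : ι → (Fin d → ℝ)) (a : κ → (Fin d → ℝ)) (b : κ → ℝ)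
    (hP : convexHull ℝ (Set.range x) = {y | ∀ j, a j ⬝ᵥ y ≤ b j})
    {n : ℕ} (hn : 2 ≤ n) (hdim : Module.finrank ℝ (vectorSpan ℝ (Set.range x)) = n)
    (hvert : ∀ p, ∃ c : Fin d → ℝ, ∀ i, x i ≠ x p → c ⬝ᵥ x p < c ⬝ᵥ x i)
    (hfacet : ∀ j, Module.finrank ℝ
      (vectorSpan ℝ (Set.range fun i : {i : ι // a j ⬝ᵥ x i = b j} => x i.1)) + 1 = n) :
    HasComplexPsdFactorization (fun i j => b j - a j ⬝ᵥ x i) (n + 1) ↔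
      ∃ (u : ι → Fin (n + 1) → ℂ) (v : κ → Fin (n + 1) → ℂ),
        ∀ i j, b j - a j ⬝ᵥ x i = Complex.normSq (u i ⬝ᵥ v j) := by
  refine ⟨fun ⟨A, B, hA, hB, hM⟩ => ?_, fun ⟨u, v, h⟩ => HasComplexPsdFactorization.of_normSq u v h⟩
  obtain ⟨hAr, hBr⟩ := GouchaGouveiaSilva2017_thm41_rankOne x a b hP hn hdim hvert hfacet A B hA hB hM
  have hAv : ∀ i, ∃ v : Fin (n + 1) → ℂ, A i = vecMulVec v (star v) := fun i =>
    eq_vecMulVec_of_posSemidef_rank_le_one (hA i) (hAr i)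
  have hBv : ∀ j, ∃ v : Fin (n + 1) → ℂ, B j = vecMulVec v (star v) := fun j =>
    eq_vecMulVec_of_posSemidef_rank_le_one (hB j) (hBr j)
  choose α hα using hAv
  choose β hβ using hBv
  refine ⟨fun i => star (α i), β, fun i j => ?_⟩
  have h := hM i j
  rw [hα i, hβ j, trace_vecMulVec_mul_vecMulVec'] at h
  exact_mod_cast h

end Literature.Combinatorics.Optimization
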